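import Mathlib
import Summits.AtomisticToContinuum.FouriersLaw.Theses.BondHeatUncertainty
import Summits.AtomisticToContinuum.FouriersLaw.Theses.FeketeSeriesLaw
import Summits.AtomisticToContinuum.FouriersLaw.Theses.JunctionLocality
import Summits.AtomisticToContinuum.FouriersLaw.Theorems.BondHeatUncertaintyPositiveOrInfiniteLimit
import Summits.AtomisticToContinuum.FouriersLaw.Theorems.BondHeatUncertaintyPositiveOrInfiniteLimitSplit
import Summits.AtomisticToContinuum.FouriersLaw.Theorems.EmbeddedDrudeMourreNessUnique
import Summits.AtomisticToContinuum.FouriersLaw.Theorems.OddSectorIrreversibilityBoundedResponseConvergesStubPositiveConductance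

/-!
# `BondHeatUncertainty.PositiveOrInfiniteLimit` (item 9128): discharging what has been proved

Helper file for the IMPORT SLOT `PositiveOrInfiniteLimit` of route `BondHeatUncertainty`
(item `stmt-AtomisticToContinuum-9128`; verbatim copies in routes `FeketeSeriesLaw` and
`PhononLorentzGas`): for `pinnedChain ω₂ lam β γ` (all parameters `> 0`), under weak-NESS uniqueness,
along every steady-state family, for every `T > 0` and response coefficients `D`,
`↑(D N) → ℓ` in `EReal` for some `ℓ ∈ (0, +∞]`.

Two hypotheses that the earlier supply-line files had to carry BY NAME are now theorems of the tree:

* weak-NESS uniqueness `NessUnique` (item 0741) — `Theorems.nessUnique_proof`;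
* positive conductance at every finite length, `0 < D N` for `N ≥ 2` (item 11750) —
  `Cruxes.BoundedResponseConverges.TwoScaleGluingLogRigidity.Stubs.positiveConductance_holds`.

This file substitutes them:

* `positiveOrInfiniteLimit_of_quasiSubadditiveResistance` — the Fekete supply line now needs ONE open
  item: `FeketeSeriesLaw.QuasiSubadditiveResistance` (14041) alone implies the slot;
* `positiveOrInfiniteLimit_of_conductanceLowerBound_of_superadditiveResistance` — the superadditive
  supply line needs `JunctionLocality.ConductanceLowerBound` (11749) and
  `JunctionLocality.SuperadditiveResistance` (11748), nothing else;
* `positiveOrInfiniteLimit_iff_resistivityConverges` — with positive conductance in hand the slot is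
  EXACTLY the statement that the bath-to-bath resistivity `R_N / N = (N-1)/(N · D_N)` converges in `ℝ`
  (its limit `r ≥ 0` is then automatic; `r = 0` is the `⊤` branch, `r > 0` the Fourier branch
  `D_N → 1/r`): the slot asks for no lower bound beyond 11750 other than through this convergence;
* `positiveOrInfiniteLimit_iff_of_nessUnique` — the uniqueness hypothesis inside the slot is idle now
  (it is a theorem), so the slot is equivalent to its uniqueness-free form.

Nothing here closes item 9128: its content — an `N`-uniform Ohmic lower bound (item 11749, necessary by
`conductanceLowerBound_of_positiveOrInfiniteLimit`) together with the existence of `lim_N D_N` in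
`EReal` — is the positivity-and-convergence half of Fourier's law for the pinned anharmonic chain
(Bonetto–Lebowitz–Rey-Bellet 2000, eq. (33)), open in print.
-/

noncomputable section

open Filter Topology Set

namespace Summit.AtomisticToContinuum.FouriersLaw.Theorems.PositiveOrInfiniteLimit

open Summit.AtomisticToContinuum.FouriersLaw.Theses
open Literature.MathematicalPhysics.KineticTheory.HeatConduction
open Summit.AtomisticToContinuum.FouriersLaw.Cruxes.BoundedResponseConverges.TwoScaleGluingLogRigidity

/-! ## Positive conductance (item 11750) is a theorem: the two series-law supply lines shorten -/

/-- Route `JunctionLocality`'s copy of `PositiveConductance` (syntactically the decl of `FeketeSeriesLaw`)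
holds: `0 < D N` for every `N ≥ 2` along every steady-state family, by the landed
`Stubs.positiveConductance_holds`. [folklore] -/
theorem junctionLocality_positiveConductance_holds : JunctionLocality.PositiveConductance :=
  Stubs.positiveConductance_holds

/-- **`QuasiSubadditiveResistance → PositiveOrInfiniteLimit`.** The Fekete supply line of the slot with
its positivity hypothesis discharged: the series law with bounded junction defect for the resistances
`(N-1)/D N` (item 14041 of route `FeketeSeriesLaw`) ALONE implies item 9128
(`positiveOrInfiniteLimit_of_feketeSeriesLaw` fed with `Stubs.positiveConductance_holds`). [folklore] -/
theorem positiveOrInfiniteLimit_of_quasiSubadditiveResistance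
    (hS : FeketeSeriesLaw.QuasiSubadditiveResistance) :
    BondHeatUncertainty.PositiveOrInfiniteLimit :=
  positiveOrInfiniteLimit_of_feketeSeriesLaw Stubs.positiveConductance_holds hS

/-- **`ConductanceLowerBound → SuperadditiveResistance → PositiveOrInfiniteLimit`.** The superadditive
supply line of the slot with its positivity hypothesis discharged: the eventual Ohmic lower bound
(item 11749) and superadditivity of the resistance up to a constant (item 11748), both of route
`JunctionLocality`, imply item 9128 (`positiveOrInfiniteLimit_of_junctionLocality` fed with
`Stubs.positiveConductance_holds`). [folklore] -/
theorem positiveOrInfiniteLimit_of_conductanceLowerBound_of_superadditiveResistance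
    (hL : JunctionLocality.ConductanceLowerBound) (hA : JunctionLocality.SuperadditiveResistance) :
    BondHeatUncertainty.PositiveOrInfiniteLimit :=
  positiveOrInfiniteLimit_of_junctionLocality Stubs.positiveConductance_holds hL hA

/-! ## The slot is the convergence of the resistivity `(N-1)/(N · D N)` -/

/-- `(N-1)/N → 1` along `ℕ`. [folklore] -/
theorem tendsto_sub_one_div_self : Tendsto (fun N : ℕ => ((N : ℝ) - 1) / (N : ℝ)) atTop (𝓝 1) := by
  have h : Tendsto (fun N : ℕ => 1 - 1 / (N : ℝ)) atTop (𝓝 (1 - 0)) :=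
    tendsto_const_nhds.sub tendsto_one_div_atTop_nhds_zero_nat
  rw [sub_zero] at h
  refine h.congr' ?_
  filter_upwards [eventually_ge_atTop 1] with N hN
  have hN0 : (N : ℝ) ≠ 0 := by exact_mod_cast (show N ≠ 0 by omega)
  field_simp

/-- **From the `EReal` limit of `D N` to the limit of the resistivity.** If `↑(D N) → ℓ` in `EReal` with
`0 < ℓ`, then the resistivity `((N-1)/D N)/N` converges to a real `r ≥ 0`: for `ℓ = ⊤`, `D N → +∞` and
`0 ≤ ((N-1)/D N)/N ≤ (D N)⁻¹ → 0` (`r = 0`); for a real `ℓ = κ > 0`, `D N → κ` (the coercion is an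
embedding) and `((N-1)/N)/D N → 1/κ` (`r = 1/κ`). Converse: `ereal_tendsto_of_tendsto_resistance_div`.
[folklore] -/
theorem exists_tendsto_resistivity_of_ereal_tendsto (D : ℕ → ℝ) {ℓ : EReal} (hℓpos : 0 < ℓ)
    (hℓ : Tendsto (fun N : ℕ => ((D N : ℝ) : EReal)) atTop (𝓝 ℓ)) :
    ∃ r : ℝ, 0 ≤ r ∧ Tendsto (fun N : ℕ => ((N : ℝ) - 1) / D N / (N : ℝ)) atTop (𝓝 r) := by
  have hswap : ∀ N : ℕ, ((N : ℝ) - 1) / D N / (N : ℝ) = ((N : ℝ) - 1) / (N : ℝ) / D N := fun N =>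
    div_right_comm _ _ _
  induction ℓ with
  | bot => exact absurd hℓpos (not_lt.2 bot_le)
  | top =>
    -- `D N → +∞`, so the resistivity tends to `0`
    have hD : Tendsto D atTop atTop := by
      rw [tendsto_atTop]
      intro b
      filter_upwards [EReal.tendsto_nhds_top_iff_real.1 hℓ b] with N hN
      exact (EReal.coe_lt_coe_iff.1 hN).le
    have hinv : Tendsto (fun N : ℕ => (D N)⁻¹) atTop (𝓝 0) := hD.inv_tendsto_atTop
    refine ⟨0, le_rfl, squeeze_zero' ?_ ?_ hinv⟩
    · filter_upwards [eventually_ge_atTop 1, hD.eventually_ge_atTop 0] with N hN hDN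
      have h1 : (0 : ℝ) ≤ (N : ℝ) - 1 := by
        have : (1 : ℝ) ≤ N := by exact_mod_cast hN
        linarith
      exact div_nonneg (div_nonneg h1 hDN) (Nat.cast_nonneg _)
    · filter_upwards [eventually_ge_atTop 1, hD.eventually_gt_atTop 0] with N hN hDN
      have hNpos : (0 : ℝ) < N := by exact_mod_cast (show 0 < N by omega)
      rw [hswap, div_le_iff₀ hDN, inv_mul_cancel₀ hDN.ne', div_le_one hNpos]
      linarith
  | coe κ =>
    -- a real positive limit `κ`: the resistivity tends to `1/κ`
    have hκ : 0 < κ := EReal.coe_pos.1 hℓpos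
    have hD : Tendsto D atTop (𝓝 κ) := EReal.tendsto_coe.1 hℓ
    refine ⟨1 / κ, (one_div_pos.2 hκ).le, ?_⟩
    have h := tendsto_sub_one_div_self.div hD hκ.ne'
    refine h.congr' (Eventually.of_forall fun N => ?_)
    simp only [Pi.div_apply, hswap]

/-- **Item 9128 ⟺ the resistivity converges.** Under the common hypotheses of the slot (parameters
`> 0`, weak-NESS uniqueness, a steady-state family `μ`, `T > 0`, response coefficients `D`), the
conclusion "`↑(D N) → ℓ` in `EReal` for some `ℓ > 0`" holds iff the bath-to-bath resistivity
`R_N/N := ((N-1)/D N)/N` has a limit in `ℝ`.  (⇒) `exists_tendsto_resistivity_of_ereal_tendsto`;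
(⇐) the limit `r` is `≥ 0` because `D N > 0` for `N ≥ 2` — positive conductance, item 11750, now the
theorem `Stubs.positiveConductance_holds` — and `ereal_tendsto_of_tendsto_resistance_div` gives
`↑(D N) → 1/r` (`r > 0`) or `→ ⊤` (`r = 0`).  So, after 11750, the slot is precisely a CONVERGENCE
statement for the resistivity (what Fekete-type series laws deliver), with no separate positivity
content at fixed `N`; the `N`-uniform lower bound 11749 is the statement `r < ∞`, i.e. it is built into
"converges in `ℝ`". [folklore] -/
theorem positiveOrInfiniteLimit_iff_resistivityConverges :
    BondHeatUncertainty.PositiveOrInfiniteLimit ↔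
      ∀ ω₂ lam β γ : ℝ, 0 < ω₂ → 0 < lam → 0 < β → 0 < γ →
        (∀ (N : ℕ) (T_L T_R : ℝ), 0 < T_L → 0 < T_R →
          ∀ μ ν : MeasureTheory.Measure (PhaseSpace N),
            (pinnedChain ω₂ lam β γ).IsSteadyState N T_L T_R μ →
            (pinnedChain ω₂ lam β γ).IsSteadyState N T_L T_R ν → μ = ν) →
        ∀ μ : (N : ℕ) → ℝ → ℝ → MeasureTheory.Measure (PhaseSpace N),
          (∀ (N : ℕ) (T_L T_R : ℝ), 0 < T_L → 0 < T_R →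
            (pinnedChain ω₂ lam β γ).IsSteadyState N T_L T_R (μ N T_L T_R)) →
          ∀ T : ℝ, 0 < T → ∀ D : ℕ → ℝ,
            (∀ N : ℕ, Tendsto (fun δ : ℝ =>
                (pinnedChain ω₂ lam β γ).totalCurrent (μ N (T + δ / 2) (T - δ / 2)) / δ)
              (𝓝[≠] 0) (𝓝 (D N))) →
            ∃ r : ℝ, Tendsto (fun N : ℕ => ((N : ℝ) - 1) / D N / (N : ℝ)) atTop (𝓝 r) := by
  constructor
  · intro hL ω₂ lam β γ hω hl hβ hγ huniq μ hμ T hT D hD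
    obtain ⟨ℓ, hℓpos, hℓ⟩ := hL ω₂ lam β γ hω hl hβ hγ huniq μ hμ T hT D hD
    obtain ⟨r, -, hr⟩ := exists_tendsto_resistivity_of_ereal_tendsto D hℓpos hℓ
    exact ⟨r, hr⟩
  · intro hR ω₂ lam β γ hω hl hβ hγ huniq μ hμ T hT D hD
    obtain ⟨r, hr⟩ := hR ω₂ lam β γ hω hl hβ hγ huniq μ hμ T hT D hD
    have hpos : ∀ N : ℕ, 2 ≤ N → 0 < D N :=
      Stubs.positiveConductance_holds ω₂ lam β γ hω hl hβ hγ huniq μ hμ T hT D hD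
    have hr0 : 0 ≤ r := by
      refine ge_of_tendsto hr ?_
      filter_upwards [eventually_ge_atTop 2] with N hN
      have h1 : (0 : ℝ) ≤ (N : ℝ) - 1 := by
        have : (2 : ℝ) ≤ N := by exact_mod_cast hN
        linarith
      exact div_nonneg (div_nonneg h1 (hpos N hN).le) (Nat.cast_nonneg _)
    exact ereal_tendsto_of_tendsto_resistance_div D hpos hr0 hr

/-! ## The uniqueness hypothesis of the slot is idle (item 0741 is a theorem) -/

/-- **The slot is equivalent to its uniqueness-free form.** Weak-NESS uniqueness for `pinnedChain`
(item 0741) is the theorem `Theorems.nessUnique_proof`, so the hypothesis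
"`IsSteadyState μ → IsSteadyState ν → μ = ν`" inside `PositiveOrInfiniteLimit` can be supplied once and
for all: item 9128 is exactly "along every steady-state family, for every `T > 0` and response
coefficients `D`, `↑(D N) → ℓ ∈ (0, +∞]`". [folklore] -/
theorem positiveOrInfiniteLimit_iff_of_nessUnique :
    BondHeatUncertainty.PositiveOrInfiniteLimit ↔
      ∀ ω₂ lam β γ : ℝ, 0 < ω₂ → 0 < lam → 0 < β → 0 < γ →
        ∀ μ : (N : ℕ) → ℝ → ℝ → MeasureTheory.Measure (PhaseSpace N),
          (∀ (N : ℕ) (T_L T_R : ℝ), 0 < T_L → 0 < T_R →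
            (pinnedChain ω₂ lam β γ).IsSteadyState N T_L T_R (μ N T_L T_R)) →
          ∀ T : ℝ, 0 < T → ∀ D : ℕ → ℝ,
            (∀ N : ℕ, Tendsto (fun δ : ℝ =>
                (pinnedChain ω₂ lam β γ).totalCurrent (μ N (T + δ / 2) (T - δ / 2)) / δ)
              (𝓝[≠] 0) (𝓝 (D N))) →
            ∃ ℓ : EReal, 0 < ℓ ∧ Tendsto (fun N : ℕ => ((D N : ℝ) : EReal)) atTop (𝓝 ℓ) := by
  constructor
  · intro hL ω₂ lam β γ hω hl hβ hγ μ hμ T hT D hD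
    exact hL ω₂ lam β γ hω hl hβ hγ (Theorems.nessUnique_proof ω₂ lam β γ hω hl hβ hγ) μ hμ T hT D hD
  · intro h ω₂ lam β γ hω hl hβ hγ _ μ hμ T hT D hD
    exact h ω₂ lam β γ hω hl hβ hγ μ hμ T hT D hD

end Summit.AtomisticToContinuum.FouriersLaw.Theorems.PositiveOrInfiniteLimit

end
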